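import Literature.MathematicalPhysics.QuantumFieldTheory.Balaban1983to89.B1Eq335GeneratingFunction
import Literature.MathematicalPhysics.QuantumFieldTheory.Balaban1983to89.B1Eq335FluctuationMeasure
import Literature.MathematicalPhysics.QuantumFieldTheory.Balaban1983to89.B1Eq333GaussianFields

/-!
# `Balaban1983to89.HiggsFluctFamilyNest` — T. Bałaban, *(Higgs)₂,₃ quantum fields in a finite volume. I. A lower bound*,
Commun. Math. Phys. **85** (1982) 603–626 [Balaban1982Higgs1], (3.35) p. 618, and *III. Renormalization*, Commun. Math.
Phys. **88** (1983) 411–445 [Balaban1983Higgs3], (1.4) p. 412: **the printed NESTS of Gaussian integrals over the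
fluctuation fields `A′_{k−1}, …, A′₀` ARE the integrals against the product measures** — the iterated reading of
`∫dA′_{k−1}e^{−½⟨A′_{k−1},(C^{(k−1)})⁻¹A′_{k−1}⟩}·…·∫dA′₀e^{−½⟨A′₀,(C^{(0)})⁻¹A′₀⟩}·T[…]` (I (3.35)) and of
`Π_{j=0}^{k−1}∫dμ_{C^{(j),L^jη}}(A′_j) T[…]` (III (1.4)), written AS PRINTED (one integral sign per fluctuation field, the
field of the highest level outermost), EQUALS the one-integral-against-the-product reading of the typer's
`B1Eq335GeneratingFunction.Data335.bracket335` / `B3Eq14AuxFunction.Data14.auxE` (Fubini–Tonelli on the finite product),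
PROVED on the concrete (Higgs)₂,₃ carrier, and the same repackaging for p14's nest on the abstract RG tower (§§5–7); theorems + the
printed nests / product laws as definitions with bodies

statement-level skeleton of published theorems with citation tags; proofs where landed; nothing here is a claim about the Yang–Mills mass gap

PDFs held: `paper:balaban1982-cmp85-higgs23-i` (journal page = PDF page + 602), `paper:balaban1983-higgs-2-3-quantum-fields-finite-volume`
(journal page = PDF page + 410); displays RE-READ THIS GEN on the ×2 renders `run/shared/lean/pub/pub-balaban/b2b-balaban-ref1/pages/
1982-cmp85-higgs23-I/1982-cmp85-higgs23-I-p016-x2.png` (p. 618: the order of the nest — `∫dA′_{k−1}` outermost, `∫dA′₀` innermost,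
each prefactor in front of its own integral sign) and `…/1983-cmp88-higgs23-III/1983-cmp88-higgs23-III-p002-x2.png` (p. 412:
`Π_{j=0}^{k−1}∫dμ_{C^{(j)},L^jη}(A′_j)`), never from the OCR layer.

CITATION HEADER (lean-in-tree rule).  lit-balaban typed skeleton (HOME `run/shared/lean/pub/lit-balaban/`), typer line (the
typer's carriers `HiggsFluctMeasure.fluctMeasure` / `fluctFamily`, `HiggsFluctFamilyDensity`, `B3Eq14Finite`,
`B1Eq335GeneratingFunction`; §§5–7 on p14's `B1Eq335FluctuationMeasure` and r14's `B1Eq333GaussianFields` over the abstract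
`B1RG242.Tower`); located member of
the SKELETON rows **B3.Eq1.4** (owner r15, `lit-balaban-r15/ROWS-B3.md`), **B1.Eq3.35** and **B1.Eq3.33** (rows of record r12
`lit-balaban-r12/ROWS-B1-part2.md` / r14 `ROWS-B1.md`, B1 fold owner r14) — cells only, zero head weight.
It closes the READING NOTE of `B1Eq335GeneratingFunction` (*"`bracket335` = the argument of `−log` with the printed NEST
of Gaussian integrals read as ONE integral against the product Lebesgue measure `Π_j dA′_j` (Fubini–Tonelli reading)"*)
and the scope line of p14's `B1Eq335FluctuationMeasure` (*"the repackaging of the iterated integral as ONE integral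
against `Measure.pi` (Fubini) … is not done here"*) ON THE CONCRETE CARRIER (§§2–4) AND ON THE ABSTRACT TOWER ITSELF (§§5–7).
Nothing of r12's, r14's, r15's or p14's is edited or re-declared; everything is consumed BY NAME.

THE SOURCE TEXT.  I p. 618 [PDF 16], (3.35), verbatim: *"E_k(e′, λ′, eA^{(k),ε}, φ) = −log[(a(L^kε)^{d−2}/2π)^{(d/2)|T₁^{(k)}|}
∫dA′_{k−1} exp(−½⟨A′_{k−1}, (C^{(k−1),L^{k−1}ε})⁻¹A′_{k−1}⟩)·…·(a(Lε)^{d−2}/2π)^{(d/2)|T₁^{(1)}|} ∫dA′₀ exp(−½⟨A′₀,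
(C^{(0),ε})⁻¹A′₀⟩)·T^ε_{a_k,L^k,eA^{(k),ε}+e′Σ_{j=0}^{k−1}A′^{(j),ε}}[exp(…)]]"* — `k` integral signs, `∫dA′_{k−1}` OUTERMOST,
`∫dA′₀` INNERMOST, each with its prefactor `c_j = (a(L^{j+1}ε)^{d−2}/2π)^{(d/2)|T₁^{(j+1)}|}` and its Gaussian weight; p. 617
[PDF 15]: *"The fields A′_j defining the components of (3.33) are independent Gaussian random variables with the covariances
C^{(j),L^jε}."*  III p. 412 [PDF 2], (1.4), verbatim: *"E_k(e′, λ′, Ω, A^{(k)}, φ) = −log[ Π_{j=0}^{k−1} ∫dμ_{C^{(j),L^jη}}(A′_j)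
T^η_{a_k,L^k,e′g_kA′+A^{(k)}}[exp(…)]]"* — a product of `k` integral signs against the probability measures `dμ_{C^{(j),L^jη}}`.

HOW IT IS TYPED (reuse; `P` = the ε-lattice family, `P.mesh j = L^jε`; families `(A′_j)_{j<k} : (j : Fin k) → VecField P j`).
* §1 (generic, [folklore]/Mathlib `Fin.snocEquiv`, `MeasureTheory.Measure.pi`): splitting the LAST factor off a finite
  DEPENDENT product of σ-finite measures — the measurable equivalence `snocMEquiv` `(x_n, (x_i)_{i<n}) ↦ (x₀,…,x_n)`, its
  measure preservation `(μ_n ⊗ Π_{i<n}μ_i) ↦ Π_{i≤n}μ_i` (`measurePreserving_snocMEquiv`, boxes + `Measure.pi_eq`), and the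
  Fubini step `∫f dΠ_{i≤n}μ_i = ∫dμ_n(t)∫f(y, t) dΠ_{i<n}μ_i(y)` for integrable `f` (`integral_pi_eq_integral_integral_snoc`) with
  the a.e. integrability of the sections (`ae_integrable_snoc`).  (The tree has a dozen copies of the NON-dependent case
  `Fin n → X`; the fluctuation fields live on different lattices `T^{(j)}` for different `j`, hence the dependent version.)
* §2 `probNest k F` = III's printed `Π_{j=0}^{k−1}∫dμ_{C^{(j),L^jη}}(A′_j) F(A′₀,…,A′_{k−1})` read LITERALLY as `k` iterated
  integrals (recursion on `k`: peel `A′_{k−1}` outermost); `gaussNest c k F` = I's printed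
  `c_{k−1}∫dA′_{k−1}e^{−½⟨A′_{k−1},(C^{(k−1)})⁻¹A′_{k−1}⟩}·…·c₀∫dA′₀e^{−½⟨A′₀,(C^{(0)})⁻¹A′₀⟩}F(A′₀,…,A′_{k−1})` read literally
  (Lebesgue `dA′_j`, typer `HiggsFluctMeasure.gaussWeight`, constants `c_j`).
WHAT IS PROVED (0 sorry; theorems only besides the definitions with bodies `snocMEquiv`, `probNest`, `gaussNest`, `lawPi`, `bgSum`,
`fluctData333`, `consMEquiv`, `Idx`, `covFull`, `split0`, `splitS`, `fluctData333Full` and two plumbing instances — no `Prop`-valued definition).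
* §2 `integral_fluctFamily_succ` / `integral_volume_succ` (one peel, product Gaussian measure / product Lebesgue measure),
  **`integral_fluctFamily_eq_probNest`** (`∫F dΠ_{j<k}dμ_{C^{(j)}} = probNest k F` for every integrable `F`; `μ₀² > 0`, `a > 0`,
  `L > 1`, `k ≤ K` — the regime in which the `dμ_{C^{(j)}}` are probability measures, typer `HiggsFluctMeasurePos`),
  **`mul_integral_famWeight_eq_gaussNest`** (`(Π_j c_j)·∫Π_j dA′_j (Π_j e^{−½⟨A′_j,(C^{(j)})⁻¹A′_j⟩}) F = gaussNest c k F` whenever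
  the weighted integrand is Lebesgue integrable).
* §3 **`integral_integrand14_eq_probNest`** / **`auxE_eq_neg_log_probNest`**: III (1.4) — the integral behind `Data14.auxE` IS the
  printed iterated integral, on the half-line `λ′ ≥ 0` in the regimes (A) `λ′λ(L^kε) > 0` / (B) `m² + δm² > 0` of the typer's
  `B3Eq14Finite` (where the integrand is integrable, `integrable_integrand14`).
* §4 **`bracket335_eq_gaussNest`** / **`genFn335C_eq_neg_log_gaussNest`**: I (3.35) — `Data335.bracket335` IS the printed nest
  `c_{k−1}∫dA′_{k−1}e^{…}·…·c₀∫dA′₀e^{…}·T^ε_{a_k,L^k,𝒜}[exp(…)](φ)` and `E_k = −log` of it, for `λ′ ≥ 0` and (`λ′ > 0` or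
  `δm²(e′,λ′) > 0`) (`μ₀² > 0`, `a > 0`, `L > 1`, `k ≤ K`); `bracket335_succ_eq_integral` (one printed peel, `k + 1 ≤ K`);
  **`bracket335_eq_mul_probNest`** (I's Gaussian integrals = `Z_j ×` III's `∫dμ_{C^{(j)}}` level by level: the bracket of (3.35)
  `= (Π_j c_jZ_j)·probNest k (T[exp(…)](φ))`, same regime).
* §5 (the ABSTRACT RG tower of r14/p14, `B1RG242.Tower`): p14's printed nest `B1Eq335FluctuationMeasure.fluctMean Φ n v` over the
  levels `1, …, n` IS ONE integral against the product law `lawPi n = Π_{j=1}^{n} dμ_j` (`dμ_j = gaussProb (W_j(C^{(j)})⁻¹)`):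
  **`fluctMean_eq_integral_lawPi`** (`= ∫ Φ(v + Σ_j α_jG_jQ*_jA′_j) dΠ_j dμ_j`, for every integrable integrand, the `dμ_j`
  probability measures), **`fluctInt_eq_mul_integral_lawPi`** / **`…'`** (the unnormalised nest = `(Π_j Z_j)·` the same integral;
  primed form with p14's `law_isProbabilityMeasure` discharging the hypotheses from the tower's Euclidean structure) — the
  *"repackaging of the iterated integral as ONE integral against `Measure.pi` (Fubini)"* that p14's scope line leaves open,
  i.e. the form in which r14's `B1Eq333GaussianFields` states the p. 617 independence sentence.
* §6 KNITTING r14 ↔ p14 on the tower: `cinvW_posDef` (every `W_j(C^{(j)})⁻¹`, `j ≥ 1`, positive definite — p14's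
  `gaussNorm_cinv_pos`), **`fluctData333`** = r14's `B1Eq333GaussianFields.FluctData` OF THE TOWER (levels `1, …, n`, covariances
  `(W_j(C^{(j)})⁻¹)⁻¹`), `fluctData333_law` / **`fluctData333_fluctLaw`** (its joint law `fluctLaw` = `lawPi`) and
  **`fluctMean_eq_integral_fluctLaw`**: p14's nest = the expectation against the law under which r14 PROVES the `A′_j`
  independent Gaussian with covariances `C^{(j)}` (`iIndepFun_fluct`, `covariance_fluct`).
* §7 **`rtIter_eq_integral_prod`** — (3.33)/(3.35) on the tower CLOSED UP: the density after `n + 1` steps (p14's `rtIter`, the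
  `(n+1)`-fold transformation with Lebesgue `dA`) `= (Π_{j≤n}c_j)·e^{−½⟨B,Δ^{(n+1)}B⟩}·Z₀(Π_{j=1}^{n}Z_j)·∫F(A′₀ + α_{n+1}G_{n+1}Q*_{n+1}B
  + Σ_{j=1}^{n}α_jG_jQ*_jA′_j) d(dμ₀ ⊗ Π_{j=1}^{n}dμ_j)` — ONE expectation against the product of the laws of `A′₀, A′_1, …, A′_n`
  (p14's nested `rtIter_eq_mean'` + `fluctMean_eq_integral_lawPi` + Fubini for `dμ₀ ⊗ Π_j dμ_j`; the hypotheses of `rtIter_eq_mean'`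
  plus integrability of the integrand against the product law).
* §8 ALL `n + 1` LEVELS UNDER ONE PRODUCT LAW: `consMEquiv` ∕ `integral_pi_eq_integral_integral_cons` (generic peel of the FIRST
  factor), `Idx` ∕ `covFull` ∕ **`fluctData333Full`** = r14's `FluctData (n + 1)` of the tower WITH the level-0 field (covariances
  `(ginvW)⁻¹`, `(cinvW (j+1))⁻¹`), `fluctData333Full_law_zero` ∕ `_law_succ` (its laws = p14's `dμ₀`, `dμ_{j+1}`), `ginvW_posDef`, and
  **`rtIter_eq_integral_fluctLawFull`** ∕ **`…'`**: p14's `rtIter` `= (Π_{j≤n}c_j)·e^{−½⟨B,Δ^{(n+1)}B⟩}·Z₀(Π_jZ_j)·∫F(A′₀ + … ) dΠ_{j=0}^{n}dμ_{C^{(j)}}`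
  — ONE expectation against the law under which r14 proves ALL of `A′₀, …, A′_n` independent Gaussian (primed form: hypotheses of
  `rtIter_eq_mean'` + integrability only).
HONEST SCOPE.  Measure-theoretic bookkeeping (Fubini–Tonelli on a finite product) only; no estimate of either paper is
asserted; outside the stated regimes (e.g. `λ′ < 0`, where the typer's `B3Eq15OneSidedInteraction` showed the fibre integral
diverges) nothing is claimed.  Unit `lit-balaban-typer` gen 32 (literature-prover-lit-balaban-typer-g32-0); HOME/FILED.md
records the proposal.
-/

open scoped BigOperators ENNReal
open _root_.MeasureTheory

namespace Literature.MathematicalPhysics.QuantumFieldTheory.Balaban1983to89.HiggsFluctFamilyNest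

/-! ## 1. Splitting the last factor off a finite dependent product of measures (Fubini) -/

section PiSnoc

variable {n : ℕ}

/-- `Fin.snocEquiv` — `(x_n, (x_i)_{i<n}) ↦ (x_0, …, x_n)` — as a MEASURABLE equivalence of the dependent products
(Mathlib's `MeasurableEquiv.piFinSuccAbove … (Fin.last n)` indexes the remaining factors by `(Fin.last n).succAbove`, this
one by `Fin.castSucc`, which is what an `ℕ`-indexed family of lattices needs). (folklore, Mathlib-level; the
measure-theoretic content of reading the printed `Π_{j=0}^{k−1}∫dμ_{C^{(j),L^jη}}(A′_j)` as iterated integrals) [cite: Balaban1983Higgs3, (1.4) p.412] -/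
def snocMEquiv (α : Fin (n + 1) → Type*) [∀ i, MeasurableSpace (α i)] :
    (α (Fin.last n) × ((i : Fin n) → α (Fin.castSucc i))) ≃ᵐ ((i : Fin (n + 1)) → α i) where
  toEquiv := Fin.snocEquiv α
  measurable_toFun := by
    refine measurable_pi_iff.2 fun i => ?_
    refine Fin.lastCases ?_ (fun j => ?_) i
    · simp only [Fin.snocEquiv_apply, Fin.snoc_last]
      exact measurable_fst
    · simp only [Fin.snocEquiv_apply, Fin.snoc_castSucc]
      exact (measurable_pi_apply j).comp measurable_snd
  measurable_invFun := by
    show Measurable fun f : (i : Fin (n + 1)) → α i => (f (Fin.last n), Fin.init f)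
    exact (measurable_pi_apply (Fin.last n)).prodMk (measurable_pi_iff.2 fun j => measurable_pi_apply (Fin.castSucc j))

variable {α : Fin (n + 1) → Type*} [∀ i, MeasurableSpace (α i)]

/-- `snocMEquiv` acts as `Fin.snoc`. (folklore, Mathlib-level; the
measure-theoretic content of reading the printed `Π_{j=0}^{k−1}∫dμ_{C^{(j),L^jη}}(A′_j)` as iterated integrals) [cite: Balaban1983Higgs3, (1.4) p.412] -/
@[simp] theorem snocMEquiv_apply (p : α (Fin.last n) × ((i : Fin n) → α (Fin.castSucc i))) :
    snocMEquiv α p = Fin.snoc p.2 p.1 := rfl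

/-- The preimage of a box under `snocMEquiv` is the product of the last side with the box of the other sides. (folklore, Mathlib-level; the
measure-theoretic content of reading the printed `Π_{j=0}^{k−1}∫dμ_{C^{(j),L^jη}}(A′_j)` as iterated integrals) [cite: Balaban1983Higgs3, (1.4) p.412] -/
theorem snocMEquiv_preimage_pi (s : (i : Fin (n + 1)) → Set (α i)) :
    snocMEquiv α ⁻¹' Set.univ.pi s = s (Fin.last n) ×ˢ Set.univ.pi fun i : Fin n => s (Fin.castSucc i) := by
  ext p
  simp only [Set.mem_preimage, Set.mem_univ_pi, Set.mem_prod, snocMEquiv_apply]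
  rw [Fin.forall_fin_succ']
  simp only [Fin.snoc_castSucc, Fin.snoc_last, and_comm]

/-- **`snocMEquiv` carries `μ_n ⊗ Π_{i<n} μ_i` to `Π_{i≤n} μ_i`** (σ-finite factors; the two measures agree on boxes).
(folklore, Mathlib-level; the
measure-theoretic content of reading the printed `Π_{j=0}^{k−1}∫dμ_{C^{(j),L^jη}}(A′_j)` as iterated integrals) [cite: Balaban1983Higgs3, (1.4) p.412] -/
theorem measurePreserving_snocMEquiv (μ : (i : Fin (n + 1)) → Measure (α i)) [∀ i, SigmaFinite (μ i)] :
    MeasurePreserving (snocMEquiv α)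
      ((μ (Fin.last n)).prod (Measure.pi fun i : Fin n => μ (Fin.castSucc i))) (Measure.pi μ) := by
  refine ⟨(snocMEquiv α).measurable, (Measure.pi_eq fun s _ => ?_).symm⟩
  rw [MeasurableEquiv.map_apply, snocMEquiv_preimage_pi, Measure.prod_prod, Measure.pi_pi,
    Fin.prod_univ_castSucc (fun i => μ i (s i)), mul_comm]

variable {E : Type*} [NormedAddCommGroup E]

/-- Integrability transported along `snocMEquiv`. (folklore, Mathlib-level; the
measure-theoretic content of reading the printed `Π_{j=0}^{k−1}∫dμ_{C^{(j),L^jη}}(A′_j)` as iterated integrals) [cite: Balaban1983Higgs3, (1.4) p.412] -/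
theorem integrable_comp_snocMEquiv_iff (μ : (i : Fin (n + 1)) → Measure (α i)) [∀ i, SigmaFinite (μ i)]
    (f : ((i : Fin (n + 1)) → α i) → E) :
    Integrable (fun p : α (Fin.last n) × ((i : Fin n) → α (Fin.castSucc i)) => f (snocMEquiv α p))
        ((μ (Fin.last n)).prod (Measure.pi fun i : Fin n => μ (Fin.castSucc i)))
      ↔ Integrable f (Measure.pi μ) :=
  (measurePreserving_snocMEquiv μ).integrable_comp_emb (snocMEquiv α).measurableEmbedding

/-- Almost every section `y ↦ f(y, t)` of an integrable `f` is integrable against `Π_{i<n}μ_i`. (folklore, Mathlib-level; the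
measure-theoretic content of reading the printed `Π_{j=0}^{k−1}∫dμ_{C^{(j),L^jη}}(A′_j)` as iterated integrals) [cite: Balaban1983Higgs3, (1.4) p.412] -/
theorem ae_integrable_snoc (μ : (i : Fin (n + 1)) → Measure (α i)) [∀ i, SigmaFinite (μ i)]
    (f : ((i : Fin (n + 1)) → α i) → E) (hf : Integrable f (Measure.pi μ)) :
    ∀ᵐ t ∂(μ (Fin.last n)), Integrable (fun y => f (Fin.snoc y t)) (Measure.pi fun i : Fin n => μ (Fin.castSucc i)) :=
  ((integrable_comp_snocMEquiv_iff μ f).2 hf).prod_right_ae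

variable [NormedSpace ℝ E]

/-- **Fubini, last factor outermost**: `∫ f dΠ_{i≤n}μ_i = ∫dμ_n(t) ∫ f(y₀,…,y_{n−1},t) dΠ_{i<n}μ_i(y)` for every
integrable `f`. (folklore, Mathlib-level; the
measure-theoretic content of reading the printed `Π_{j=0}^{k−1}∫dμ_{C^{(j),L^jη}}(A′_j)` as iterated integrals) [cite: Balaban1983Higgs3, (1.4) p.412] -/
theorem integral_pi_eq_integral_integral_snoc (μ : (i : Fin (n + 1)) → Measure (α i)) [∀ i, SigmaFinite (μ i)]
    (f : ((i : Fin (n + 1)) → α i) → E) (hf : Integrable f (Measure.pi μ)) :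
    ∫ x, f x ∂Measure.pi μ
      = ∫ t, ∫ y, f (Fin.snoc y t) ∂(Measure.pi fun i : Fin n => μ (Fin.castSucc i)) ∂(μ (Fin.last n)) := by
  rw [← (measurePreserving_snocMEquiv μ).integral_comp',
    integral_prod (fun p => f (snocMEquiv α p)) ((integrable_comp_snocMEquiv_iff μ f).2 hf)]
  rfl

end PiSnoc

/-! ## 2. The printed nests over the fluctuation fields and the product measures -/

open Literature.MathematicalPhysics.QuantumFieldTheory.Balaban1983to89.HiggsLattice
open Literature.MathematicalPhysics.QuantumFieldTheory.Balaban1983to89.HiggsFluctMeasure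

variable {P : HiggsLattice.Params}

section Nests

variable (P)

/-- **III (1.4) p. 412 read literally**: `Π_{j=0}^{k−1}∫dμ_{C^{(j),L^jη}}(A′_j) F(A′₀,…,A′_{k−1})` as `k` ITERATED integrals
against the probability measures `dμ_{C^{(j),L^jη}}` (typer `HiggsFluctMeasure.fluctMeasure`), the field of the highest level
integrated outermost: `probNest 0 F = F(∅)`, `probNest (k+1) F = ∫dμ_{C^{(k)}}(A′_k) probNest k (A′ ↦ F(A′, A′_k))`.
[cite: Balaban1983Higgs3, (1.4) p.412] -/
noncomputable def probNest (msq a : ℝ) {E : Type*} [NormedAddCommGroup E] [NormedSpace ℝ E] :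
    (k : ℕ) → (((j : Fin k) → HiggsLattice.VecField P j) → E) → E
  | 0, F => F fun j => j.elim0
  | k + 1, F => ∫ Ak, probNest msq a k (fun A' => F (Fin.snoc A' Ak)) ∂(fluctMeasure P msq a k)

/-- **I (3.35) p. 618 read literally**: `c_{k−1}∫dA′_{k−1}e^{−½⟨A′_{k−1},(C^{(k−1)})⁻¹A′_{k−1}⟩}·…·c₀∫dA′₀e^{−½⟨A′₀,(C^{(0)})⁻¹A′₀⟩}
F(A′₀,…,A′_{k−1})` as `k` ITERATED Lebesgue integrals with the Gaussian weights `e^{−½⟨A′_j,(C^{(j),L^jε})⁻¹A′_j⟩}` (typer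
`HiggsFluctMeasure.gaussWeight`) and level constants `c_j` (in (3.35): `c_j = (a(L^{j+1}ε)^{d−2}/2π)^{(d/2)|T₁^{(j+1)}|}` =
`Data335.rtConst j`), `∫dA′_{k−1}` outermost: `gaussNest c 0 F = F(∅)`, `gaussNest c (k+1) F = c_k∫dA′_k e^{−½⟨A′_k,(C^{(k)})⁻¹A′_k⟩}
gaussNest c k (A′ ↦ F(A′, A′_k))`. [cite: Balaban1982Higgs1, (3.35) p.618] -/
noncomputable def gaussNest (msq a : ℝ) (c : ℕ → ℝ) :
    (k : ℕ) → (((j : Fin k) → HiggsLattice.VecField P j) → ℝ) → ℝ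
  | 0, F => F fun j => j.elim0
  | k + 1, F => c k * ∫ Ak : HiggsLattice.VecField P k,
      gaussWeight P msq a k Ak * gaussNest msq a c k (fun A' => F (Fin.snoc A' Ak))

variable {P}

/-- Unfolding of `probNest` at `k = 0`. [cite: Balaban1983Higgs3, (1.4) p.412] -/
theorem probNest_zero (msq a : ℝ) {E : Type*} [NormedAddCommGroup E] [NormedSpace ℝ E]
    (F : ((j : Fin 0) → HiggsLattice.VecField P j) → E) :
    probNest P msq a 0 F = F fun j => j.elim0 := rfl

/-- Unfolding of `probNest` at `k + 1`: the field `A′_k` of the highest level is integrated outermost.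
[cite: Balaban1983Higgs3, (1.4) p.412] -/
theorem probNest_succ (msq a : ℝ) {E : Type*} [NormedAddCommGroup E] [NormedSpace ℝ E] (k : ℕ)
    (F : ((j : Fin (k + 1)) → HiggsLattice.VecField P j) → E) :
    probNest P msq a (k + 1) F = ∫ Ak, probNest P msq a k (fun A' => F (Fin.snoc A' Ak)) ∂(fluctMeasure P msq a k) := rfl

/-- Unfolding of `gaussNest` at `k = 0`. [cite: Balaban1982Higgs1, (3.35) p.618] -/
theorem gaussNest_zero (msq a : ℝ) (c : ℕ → ℝ) (F : ((j : Fin 0) → HiggsLattice.VecField P j) → ℝ) :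
    gaussNest P msq a c 0 F = F fun j => j.elim0 := rfl

/-- Unfolding of `gaussNest` at `k + 1`: `c_k∫dA′_k e^{−½⟨A′_k,(C^{(k)})⁻¹A′_k⟩}(…)` outermost. [cite: Balaban1982Higgs1, (3.35) p.618] -/
theorem gaussNest_succ (msq a : ℝ) (c : ℕ → ℝ) (k : ℕ) (F : ((j : Fin (k + 1)) → HiggsLattice.VecField P j) → ℝ) :
    gaussNest P msq a c (k + 1) F
      = c k * ∫ Ak : HiggsLattice.VecField P k,
          gaussWeight P msq a k Ak * gaussNest P msq a c k (fun A' => F (Fin.snoc A' Ak)) := rfl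

variable {E : Type*} [NormedAddCommGroup E] [NormedSpace ℝ E]

/-- The product of no fluctuation measures integrates by evaluation at the empty family. [cite: Balaban1983Higgs3, (1.4) p.412] -/
theorem integral_fluctFamily_zero [CompleteSpace E] (msq a : ℝ) (F : ((j : Fin 0) → HiggsLattice.VecField P j) → E) :
    ∫ A', F A' ∂(fluctFamily P msq a 0) = F fun j => j.elim0 := by
  rw [fluctFamily_zero, integral_dirac]

/-- In the paper's regime every factor `dμ_{C^{(j),L^jη}}`, `j ≤ k ≤ K`, is a probability measure, hence σ-finite.
[cite: Balaban1983Higgs3, (1.4) p.412] -/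
theorem sigmaFinite_fluctMeasure_fin {msq a : ℝ} (hmsq : 0 < msq) (ha : 0 < a) (hL : 1 < (P.L : ℝ)) {k : ℕ}
    (hk : k ≤ P.K) (j : Fin (k + 1)) : SigmaFinite (fluctMeasure P msq a j) := by
  haveI := HiggsFluctMeasurePos.fluctMeasure_isProbability (P := P) hmsq ha hL ((Nat.lt_succ_iff.1 j.isLt).trans hk)
  infer_instance

/-- **One peel of III's product measure**: `∫F dΠ_{j≤k}dμ_{C^{(j)}} = ∫dμ_{C^{(k)}}(A′_k) ∫F(A′, A′_k) dΠ_{j<k}dμ_{C^{(j)}}(A′)` for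
every integrable `F` (`μ₀² > 0`, `a > 0`, `L > 1`, `k ≤ K`). [cite: Balaban1983Higgs3, (1.4) p.412] -/
theorem integral_fluctFamily_succ {msq a : ℝ} (hmsq : 0 < msq) (ha : 0 < a) (hL : 1 < (P.L : ℝ)) {k : ℕ}
    (hk : k ≤ P.K) (F : ((j : Fin (k + 1)) → HiggsLattice.VecField P j) → E)
    (hF : Integrable F (fluctFamily P msq a (k + 1))) :
    ∫ A', F A' ∂(fluctFamily P msq a (k + 1))
      = ∫ Ak, ∫ A', F (Fin.snoc A' Ak) ∂(fluctFamily P msq a k) ∂(fluctMeasure P msq a k) := by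
  haveI := sigmaFinite_fluctMeasure_fin hmsq ha hL hk
  exact integral_pi_eq_integral_integral_snoc (fun j : Fin (k + 1) => fluctMeasure P msq a j) F hF

omit [NormedSpace ℝ E] in
/-- Almost every top section of an integrable `F` is integrable against the lower product. [cite: Balaban1983Higgs3, (1.4) p.412] -/
theorem ae_integrable_snoc_fluctFamily {msq a : ℝ} (hmsq : 0 < msq) (ha : 0 < a) (hL : 1 < (P.L : ℝ)) {k : ℕ}
    (hk : k ≤ P.K) (F : ((j : Fin (k + 1)) → HiggsLattice.VecField P j) → E)
    (hF : Integrable F (fluctFamily P msq a (k + 1))) :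
    ∀ᵐ Ak ∂(fluctMeasure P msq a k), Integrable (fun A' => F (Fin.snoc A' Ak)) (fluctFamily P msq a k) := by
  haveI := sigmaFinite_fluctMeasure_fin hmsq ha hL hk
  exact ae_integrable_snoc (fun j : Fin (k + 1) => fluctMeasure P msq a j) F hF

/-- **III (1.4)'s `Π_{j=0}^{k−1}∫dμ_{C^{(j),L^jη}}(A′_j)` — iterated integrals = product measure**: `∫F dΠ_{j<k}dμ_{C^{(j)}} =
probNest k F` for every integrable `F` (`μ₀² > 0`, `a > 0`, `L > 1`, `k ≤ K`). [cite: Balaban1983Higgs3, (1.4) p.412] -/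
theorem integral_fluctFamily_eq_probNest [CompleteSpace E] {msq a : ℝ} (hmsq : 0 < msq) (ha : 0 < a) (hL : 1 < (P.L : ℝ)) :
    ∀ {k : ℕ}, k ≤ P.K → ∀ (F : ((j : Fin k) → HiggsLattice.VecField P j) → E),
      Integrable F (fluctFamily P msq a k) → ∫ A', F A' ∂(fluctFamily P msq a k) = probNest P msq a k F
  | 0, _, F, _ => by rw [integral_fluctFamily_zero, probNest_zero]
  | k + 1, hk, F, hF => by
      have hk' : k ≤ P.K := (Nat.le_succ k).trans hk
      rw [integral_fluctFamily_succ hmsq ha hL hk' F hF, probNest_succ]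
      refine integral_congr_ae ?_
      filter_upwards [ae_integrable_snoc_fluctFamily hmsq ha hL hk' F hF] with Ak hAk
      exact integral_fluctFamily_eq_probNest hmsq ha hL hk' _ hAk

/-- **One peel of the product Lebesgue measure**: `∫Φ Π_{j≤k}dA′_j = ∫dA′_k ∫Φ(A′, A′_k) Π_{j<k}dA′_j` for every integrable `Φ`.
[cite: Balaban1982Higgs1, (3.35) p.618] -/
theorem integral_volume_succ {k : ℕ} (Φ : ((j : Fin (k + 1)) → HiggsLattice.VecField P j) → E) (hΦ : Integrable Φ) :
    ∫ A', Φ A' = ∫ Ak : HiggsLattice.VecField P k, ∫ A' : (j : Fin k) → HiggsLattice.VecField P j, Φ (Fin.snoc A' Ak) := by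
  have h := integral_pi_eq_integral_integral_snoc
    (fun j : Fin (k + 1) => (volume : Measure (HiggsLattice.VecField P j))) Φ (by rwa [← volume_pi])
  rw [volume_pi]
  exact h

omit [NormedSpace ℝ E] in
/-- Almost every top section of a Lebesgue-integrable `Φ` is Lebesgue integrable. [cite: Balaban1982Higgs1, (3.35) p.618] -/
theorem ae_integrable_snoc_volume {k : ℕ} (Φ : ((j : Fin (k + 1)) → HiggsLattice.VecField P j) → E) (hΦ : Integrable Φ) :
    ∀ᵐ Ak : HiggsLattice.VecField P k, Integrable fun A' : (j : Fin k) → HiggsLattice.VecField P j => Φ (Fin.snoc A' Ak) := by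
  have h := ae_integrable_snoc (fun j : Fin (k + 1) => (volume : Measure (HiggsLattice.VecField P j))) Φ (by rwa [← volume_pi])
  rw [volume_pi]
  exact h

/-- The product of no Lebesgue measures integrates by evaluation at the empty family. [cite: Balaban1982Higgs1, (3.35) p.618] -/
theorem integral_volume_zero [CompleteSpace E] (G : ((j : Fin 0) → HiggsLattice.VecField P j) → E) :
    ∫ A' : (j : Fin 0) → HiggsLattice.VecField P j, G A' = G fun j => j.elim0 := by
  rw [volume_pi, Measure.pi_of_empty (fun j : Fin 0 => (volume : Measure (HiggsLattice.VecField P j))) (fun j => j.elim0),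
    integral_dirac]

/-- The Gaussian weights of a family with one more field: `Π_{j≤k}w_j((A′,A′_k)_j) = (Π_{j<k}w_j(A′_j))·w_k(A′_k)`.
[cite: Balaban1982Higgs1, (3.35) p.618] -/
theorem prod_gaussWeight_snoc (msq a : ℝ) {k : ℕ} (A' : (j : Fin k) → HiggsLattice.VecField P j) (Ak : HiggsLattice.VecField P k) :
    ∏ j : Fin (k + 1), gaussWeight P msq a j ((Fin.snoc A' Ak : (j : Fin (k + 1)) → HiggsLattice.VecField P j) j)
      = (∏ j : Fin k, gaussWeight P msq a j (A' j)) * gaussWeight P msq a k Ak := by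
  rw [Fin.prod_univ_castSucc]
  simp only [Fin.snoc_castSucc, Fin.snoc_last, Fin.val_castSucc, Fin.val_last]

/-- The level constants of a family with one more field: `Π_{j≤k}c_j = (Π_{j<k}c_j)·c_k`. [cite: Balaban1982Higgs1, (3.35) p.618] -/
theorem prod_const_succ (c : ℕ → ℝ) (k : ℕ) :
    ∏ j : Fin (k + 1), c (j : ℕ) = (∏ j : Fin k, c (j : ℕ)) * c k := by
  rw [Fin.prod_univ_castSucc]
  simp only [Fin.val_castSucc, Fin.val_last]

/-- An integrable top section of the weighted integrand stays integrable after the positive weight `w_k(A′_k)` of the top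
field is divided out. [cite: Balaban1982Higgs1, (3.35) p.618] -/
theorem integrable_section_of_snoc (msq a : ℝ) {k : ℕ} (F : ((j : Fin (k + 1)) → HiggsLattice.VecField P j) → ℝ)
    (Ak : HiggsLattice.VecField P k)
    (h : Integrable fun A' : (j : Fin k) → HiggsLattice.VecField P j =>
      (∏ j : Fin (k + 1), gaussWeight P msq a j ((Fin.snoc A' Ak : (j : Fin (k + 1)) → HiggsLattice.VecField P j) j))
        * F (Fin.snoc A' Ak)) :
    Integrable fun A' : (j : Fin k) → HiggsLattice.VecField P j =>
      (∏ j : Fin k, gaussWeight P msq a j (A' j)) * F (Fin.snoc A' Ak) := by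
  have hw : IsUnit (gaussWeight P msq a k Ak) := isUnit_iff_ne_zero.2 (gaussWeight_pos msq a k Ak).ne'
  refine (integrable_const_mul_iff hw _).1 (h.congr (Filter.Eventually.of_forall fun A' => ?_))
  show (∏ j : Fin (k + 1), gaussWeight P msq a j ((Fin.snoc A' Ak : (j : Fin (k + 1)) → HiggsLattice.VecField P j) j))
      * F (Fin.snoc A' Ak)
    = gaussWeight P msq a k Ak * ((∏ j : Fin k, gaussWeight P msq a j (A' j)) * F (Fin.snoc A' Ak))
  rw [prod_gaussWeight_snoc]
  ring

/-- **I (3.35)'s nest of Gaussian integrals — iterated = product**: `(Π_{j<k}c_j)·∫Π_j dA′_j (Π_j e^{−½⟨A′_j,(C^{(j)})⁻¹A′_j⟩})F =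
gaussNest c k F` whenever the weighted integrand is Lebesgue integrable. [cite: Balaban1982Higgs1, (3.35) p.618] -/
theorem mul_integral_famWeight_eq_gaussNest (msq a : ℝ) (c : ℕ → ℝ) :
    ∀ {k : ℕ} (F : ((j : Fin k) → HiggsLattice.VecField P j) → ℝ),
      (Integrable fun A' : (j : Fin k) → HiggsLattice.VecField P j => (∏ j : Fin k, gaussWeight P msq a j (A' j)) * F A') →
      (∏ j : Fin k, c (j : ℕ)) * ∫ A' : (j : Fin k) → HiggsLattice.VecField P j, (∏ j : Fin k, gaussWeight P msq a j (A' j)) * F A'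
        = gaussNest P msq a c k F
  | 0, F, _ => by
      rw [gaussNest_zero, integral_volume_zero]
      simp only [Finset.univ_eq_empty, Finset.prod_empty, one_mul]
  | k + 1, F, hF => by
      rw [gaussNest_succ, integral_volume_succ _ hF, prod_const_succ]
      have hinner : ∀ Ak : HiggsLattice.VecField P k,
          (∫ A' : (j : Fin k) → HiggsLattice.VecField P j,
              (∏ j : Fin (k + 1), gaussWeight P msq a j ((Fin.snoc A' Ak : (j : Fin (k + 1)) → HiggsLattice.VecField P j) j))
                * F (Fin.snoc A' Ak))
            = gaussWeight P msq a k Ak * ∫ A' : (j : Fin k) → HiggsLattice.VecField P j,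
                (∏ j : Fin k, gaussWeight P msq a j (A' j)) * F (Fin.snoc A' Ak) := by
        intro Ak
        rw [← integral_const_mul]
        refine integral_congr_ae (Filter.Eventually.of_forall fun A' => ?_)
        show (∏ j : Fin (k + 1), gaussWeight P msq a j ((Fin.snoc A' Ak : (j : Fin (k + 1)) → HiggsLattice.VecField P j) j))
            * F (Fin.snoc A' Ak)
          = gaussWeight P msq a k Ak * ((∏ j : Fin k, gaussWeight P msq a j (A' j)) * F (Fin.snoc A' Ak))
        rw [prod_gaussWeight_snoc]
        ring
      simp_rw [hinner]
      rw [mul_comm (∏ j : Fin k, c (j : ℕ)) (c k), mul_assoc, ← integral_const_mul (∏ j : Fin k, c (j : ℕ))]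
      congr 1
      refine integral_congr_ae ?_
      filter_upwards [ae_integrable_snoc_volume _ hF] with Ak hAk
      rw [← mul_integral_famWeight_eq_gaussNest msq a c (fun A' => F (Fin.snoc A' Ak))
        (integrable_section_of_snoc msq a F Ak hAk)]
      ring

end Nests

/-! ## 3. III (1.4): the integral behind `E_k` is the printed iterated integral -/

section AuxE14

open Literature.MathematicalPhysics.QuantumFieldTheory.Balaban1983to89.B3Eq14AuxFunction

variable {N k : ℕ} (D : Data14 P N k)

/-- **III (1.4) p. 412 — `Π_{j=0}^{k−1}∫dμ_{C^{(j),L^jη}}(A′_j) T^η[Ω, exp(…)](φ)` read as `k` ITERATED integrals IS the integral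
against the product measure behind the typed `Data14.auxE`**, on the half-line `λ′λ(L^kε) ≥ 0` in the regimes (A) `λ′λ(L^kε) > 0`
or (B) `m² + δm²(e′,λ′,x) > 0` on `Ω₁` (`μ₀² > 0`, `a > 0`, `L > 1`, `k ≤ K`, `m² > 0`, `L^kε ≠ 0`; the integrand is then
integrable, typer `B3Eq14Finite.integrable_integrand14`). [cite: Balaban1983Higgs3, (1.4) p.412] -/
theorem integral_integrand14_eq_probNest (hmsq : 0 < D.msq) (ha : 0 < D.a) (hL : 1 < (P.L : ℝ)) (hk : k ≤ P.K)
    (hm2 : 0 < D.m2) (hℓ : D.ell ≠ 0) {e' lam' : ℝ} (hq : 0 ≤ lam' * D.lamRun)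
    (hreg : 0 < lam' * D.lamRun ∨ ∀ x ∈ D.Ω₁, 0 < D.m2 + D.dm2 e' lam' x)
    (Ak : HiggsLattice.VecField P 0) (φ : HiggsLattice.ScalarField P k N) :
    ∫ A', D.integrand14 e' lam' Ak φ A' ∂(fluctFamily P D.msq D.a k) = probNest P D.msq D.a k (D.integrand14 e' lam' Ak φ) :=
  integral_fluctFamily_eq_probNest hmsq ha hL hk _ (B3Eq14Finite.integrable_integrand14 D hmsq ha hL hk hm2 hℓ hq hreg Ak φ)

/-- **(1.4) with the printed iterated integral**: `E_k(e′, λ′, Ω, A^{(k)}, φ) = −log[Π_{j=0}^{k−1}∫dμ_{C^{(j),L^jη}}(A′_j) T^η[Ω, exp(…)](φ)]`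
with the right side read literally (same regimes). [cite: Balaban1983Higgs3, (1.4) p.412] -/
theorem auxE_eq_neg_log_probNest (hmsq : 0 < D.msq) (ha : 0 < D.a) (hL : 1 < (P.L : ℝ)) (hk : k ≤ P.K)
    (hm2 : 0 < D.m2) (hℓ : D.ell ≠ 0) {e' lam' : ℝ} (hq : 0 ≤ lam' * D.lamRun)
    (hreg : 0 < lam' * D.lamRun ∨ ∀ x ∈ D.Ω₁, 0 < D.m2 + D.dm2 e' lam' x)
    (Ak : HiggsLattice.VecField P 0) (φ : HiggsLattice.ScalarField P k N) :
    D.auxE e' lam' Ak φ = -Real.log (probNest P D.msq D.a k (D.integrand14 e' lam' Ak φ)) := by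
  rw [← integral_integrand14_eq_probNest D hmsq ha hL hk hm2 hℓ hq hreg Ak φ]
  rfl

end AuxE14

/-! ## 4. I (3.35): `bracket335` is the printed nest of Gaussian integrals -/

section Bracket335

open Literature.MathematicalPhysics.QuantumFieldTheory.Balaban1983to89.B1Eq335GeneratingFunction

variable {N k : ℕ} (D : Data335 P N k)

/-- The `A′`-integrand `T^ε_{a_k,L^k,𝒜}[exp(…)](φ)` of (3.35) is integrable against III's product measure `Π_j dμ_{C^{(j),L^jε}}`
for `λ′ ≥ 0` and (`λ′ > 0` or `δm²(e′,λ′) > 0`) (`μ₀² > 0`, `a > 0`, `L > 1`, `k ≤ K`): it IS III's integrand of the dictionary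
data (`Data335.rt335_density335_eq_integrand14`, scalar mass `1` in the dictionary), integrable by the typer's
`B3Eq14Finite.integrable_integrand14`. [cite: Balaban1982Higgs1, (3.35) p.618] -/
theorem integrable_rt335_fluctFamily (hmu : 0 < D.mu0sq) (ha : 0 < D.a) (hL : 1 < (P.L : ℝ)) (hk : k ≤ P.K)
    {e' l' : ℝ} (hl : 0 ≤ l') (hreg : 0 < l' ∨ 0 < D.dm2 e' l')
    (Ak : HiggsLattice.VecField P 0) (φ : HiggsLattice.ScalarField P k N) :
    Integrable (fun A' : (j : Fin k) → HiggsLattice.VecField P j => D.rt335 Ak e' A' (D.density335 Ak e' l' A') φ)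
      (fluctFamily P D.mu0sq D.a k) := by
  have hq : 0 ≤ l' * (D.toData14 1).lamRun := by
    show 0 ≤ l' * 1
    rw [mul_one]; exact hl
  have hreg' : 0 < l' * (D.toData14 1).lamRun ∨ ∀ x ∈ (D.toData14 1).Ω₁, 0 < (D.toData14 1).m2 + (D.toData14 1).dm2 e' l' x := by
    rcases hreg with h | h
    · left; show 0 < l' * 1; rw [mul_one]; exact h
    · right; intro x _; show 0 < 1 + (D.dm2 e' l' - 1); linarith
  refine (B3Eq14Finite.integrable_integrand14 (D.toData14 1) hmu ha hL hk one_pos one_ne_zero hq hreg' Ak φ).congr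
    (Filter.Eventually.of_forall fun A' => ?_)
  exact (D.rt335_density335_eq_integrand14 1 e' l' Ak φ A').symm

/-- The weighted `A′`-integrand of (3.35), `(Π_j e^{−½⟨A′_j,(C^{(j)})⁻¹A′_j⟩})·T^ε_{a_k,L^k,𝒜}[exp(…)](φ)`, is Lebesgue integrable
(same regime; the product measure is the weighted Lebesgue measure, `HiggsFluctFamilyDensity.integrable_fluctFamily_iff`).
[cite: Balaban1982Higgs1, (3.35) p.618] -/
theorem integrable_famWeight_mul_rt335 (hmu : 0 < D.mu0sq) (ha : 0 < D.a) (hL : 1 < (P.L : ℝ)) (hk : k ≤ P.K)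
    {e' l' : ℝ} (hl : 0 ≤ l') (hreg : 0 < l' ∨ 0 < D.dm2 e' l')
    (Ak : HiggsLattice.VecField P 0) (φ : HiggsLattice.ScalarField P k N) :
    Integrable fun A' : (j : Fin k) → HiggsLattice.VecField P j =>
      D.famWeight A' * D.rt335 Ak e' A' (D.density335 Ak e' l' A') φ := by
  have hint := (HiggsFluctFamilyDensity.integrable_fluctFamily_iff hmu ha hL hk _).1
    (integrable_rt335_fluctFamily D hmu ha hL hk hl hreg Ak φ)
  refine hint.congr (Filter.Eventually.of_forall fun A' => ?_)
  show D.rt335 Ak e' A' (D.density335 Ak e' l' A') φ * ∏ j : Fin k, gaussWeight P D.mu0sq D.a j (A' j)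
    = D.famWeight A' * D.rt335 Ak e' A' (D.density335 Ak e' l' A') φ
  rw [mul_comm]
  rfl

/-- **I's Gaussian integrals are `Z_j ×` III's `∫dμ_{C^{(j)}}`, level by level**: the bracket of (3.35) equals
`(Π_j c_jZ_j)·[Π_{j=0}^{k−1}∫dμ_{C^{(j),L^jε}}(A′_j)] T[exp(…)](φ)` with III's printed iterated probability integrals (`probNest`),
`Z_j = ∫dA′_je^{−½⟨A′_j,(C^{(j)})⁻¹A′_j⟩}` (same regime). [cite: Balaban1982Higgs1, (3.35) p.618] -/
theorem bracket335_eq_mul_probNest (hmu : 0 < D.mu0sq) (ha : 0 < D.a) (hL : 1 < (P.L : ℝ)) (hk : k ≤ P.K)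
    {e' l' : ℝ} (hl : 0 ≤ l') (hreg : 0 < l' ∨ 0 < D.dm2 e' l')
    (Ak : HiggsLattice.VecField P 0) (φ : HiggsLattice.ScalarField P k N) :
    D.bracket335 e' l' Ak φ
      = (∏ j : Fin k, D.rtConst j * gaussNorm P D.mu0sq D.a j) *
          probNest P D.mu0sq D.a k (fun A' => D.rt335 Ak e' A' (D.density335 Ak e' l' A') φ) := by
  rw [D.bracket335_eq_mul_integral_fluctFamily hmu ha hL hk,
    integral_fluctFamily_eq_probNest hmu ha hL hk _ (integrable_rt335_fluctFamily D hmu ha hL hk hl hreg Ak φ)]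

/-- **I (3.35) p. 618 — the printed NEST of Gaussian integrals IS `bracket335`**:
`(Π_j c_j)·∫Π_j dA′_j(Π_j e^{−½⟨A′_j,(C^{(j)})⁻¹A′_j⟩})T[exp(…)](φ) = c_{k−1}∫dA′_{k−1}e^{−½⟨A′_{k−1},(C^{(k−1)})⁻¹A′_{k−1}⟩}·…·
c₀∫dA′₀e^{−½⟨A′₀,(C^{(0)})⁻¹A′₀⟩}·T^ε_{a_k,L^k,eA^{(k),ε}+e′ΣA′^{(j),ε}}[exp(…)](φ)`, `c_j = (a(L^{j+1}ε)^{d−2}/2π)^{(d/2)|T₁^{(j+1)}|}`,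
for `λ′ ≥ 0` and (`λ′ > 0` or `δm²(e′,λ′) > 0`) (`μ₀² > 0`, `a > 0`, `L > 1`, `k ≤ K`). [cite: Balaban1982Higgs1, (3.35) p.618] -/
theorem bracket335_eq_gaussNest (hmu : 0 < D.mu0sq) (ha : 0 < D.a) (hL : 1 < (P.L : ℝ)) (hk : k ≤ P.K)
    {e' l' : ℝ} (hl : 0 ≤ l') (hreg : 0 < l' ∨ 0 < D.dm2 e' l')
    (Ak : HiggsLattice.VecField P 0) (φ : HiggsLattice.ScalarField P k N) :
    D.bracket335 e' l' Ak φ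
      = gaussNest P D.mu0sq D.a D.rtConst k (fun A' => D.rt335 Ak e' A' (D.density335 Ak e' l' A') φ) :=
  mul_integral_famWeight_eq_gaussNest D.mu0sq D.a D.rtConst _ (integrable_famWeight_mul_rt335 D hmu ha hL hk hl hreg Ak φ)

/-- **(3.35) with the printed nest**: `E_k(e′, λ′, eA^{(k),ε}, φ) = −log[c_{k−1}∫dA′_{k−1}e^{…}·…·c₀∫dA′₀e^{…}·T[exp(…)](φ)]`
read literally (same regime). [cite: Balaban1982Higgs1, (3.35) p.618] -/
theorem genFn335C_eq_neg_log_gaussNest (hmu : 0 < D.mu0sq) (ha : 0 < D.a) (hL : 1 < (P.L : ℝ)) (hk : k ≤ P.K)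
    {e' l' : ℝ} (hl : 0 ≤ l') (hreg : 0 < l' ∨ 0 < D.dm2 e' l')
    (Ak : HiggsLattice.VecField P 0) (φ : HiggsLattice.ScalarField P k N) :
    D.genFn335C e' l' Ak φ
      = -Real.log (gaussNest P D.mu0sq D.a D.rtConst k (fun A' => D.rt335 Ak e' A' (D.density335 Ak e' l' A') φ)) := by
  rw [← bracket335_eq_gaussNest D hmu ha hL hk hl hreg Ak φ]
  rfl

/-- **One printed peel of (3.35)** (the form in which the induction `k ↦ k + 1` of pp. 623–624 uses it): for `k + 1 ≤ K`,
`bracket_{k+1} = c_k ∫dA′_k e^{−½⟨A′_k,(C^{(k),L^kε})⁻¹A′_k⟩} · [(Π_{j<k}c_j)·∫Π_{j<k}dA′_j(Π_{j<k}e^{…})·T[exp(…)](φ)](A′_k)` —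
the outermost Gaussian integral split off the one-integral reading (same regime). [cite: Balaban1982Higgs1, (3.35) p.618] -/
theorem bracket335_succ_eq_integral (D : Data335 P N (k + 1)) (hmu : 0 < D.mu0sq) (ha : 0 < D.a) (hL : 1 < (P.L : ℝ))
    (hk : k + 1 ≤ P.K) {e' l' : ℝ} (hl : 0 ≤ l') (hreg : 0 < l' ∨ 0 < D.dm2 e' l')
    (Ak : HiggsLattice.VecField P 0) (φ : HiggsLattice.ScalarField P (k + 1) N) :
    D.bracket335 e' l' Ak φ
      = D.rtConst k * ∫ A'k : HiggsLattice.VecField P k, gaussWeight P D.mu0sq D.a k A'k *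
          ((∏ j : Fin k, D.rtConst j) * ∫ A' : (j : Fin k) → HiggsLattice.VecField P j,
            (∏ j : Fin k, gaussWeight P D.mu0sq D.a j (A' j)) *
              D.rt335 Ak e' (Fin.snoc A' A'k) (D.density335 Ak e' l' (Fin.snoc A' A'k)) φ) := by
  rw [bracket335_eq_gaussNest D hmu ha hL hk hl hreg Ak φ, gaussNest_succ]
  congr 1
  refine integral_congr_ae ?_
  filter_upwards [ae_integrable_snoc_volume _ (integrable_famWeight_mul_rt335 D hmu ha hL hk hl hreg Ak φ)] with A'k hA'k
  congr 1
  exact (mul_integral_famWeight_eq_gaussNest D.mu0sq D.a D.rtConst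
    (fun B => D.rt335 Ak e' (Fin.snoc B A'k) (D.density335 Ak e' l' (Fin.snoc B A'k)) φ)
    (integrable_section_of_snoc D.mu0sq D.a (fun B => D.rt335 Ak e' B (D.density335 Ak e' l' B) φ) A'k hA'k)).symm

end Bracket335

/-! ## 5. The abstract RG tower: p14's nest `fluctMean` is ONE integral against the product law `Π_{j=1}^{n} dμ_j` -/

section AbstractTower

open Matrix
open Literature.MathematicalPhysics.QuantumFieldTheory.Balaban1983to89.B1Eq333FluctuationIntegrals
open Literature.MathematicalPhysics.QuantumFieldTheory.Balaban1983to89.B1Eq335FluctuationMeasure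

variable {ι : Type} [Fintype ι] [DecidableEq ι] (T : B1RG242.Tower ℝ ι) (W : ∀ j, Matrix (T.κ j) (T.κ j) ℝ)

/-- **The product law `Π_{j=1}^{n} dμ_j(A′_j)`** of the fluctuation fields `A′_1, …, A′_n` of a consistent RG tower
(`dμ_j = B2Eq228Conditioning.gaussProb (W_j(C^{(j)})⁻¹)`, p14's `B1Eq335FluctuationMeasure.cinvW`; family index `j − 1 : Fin n`)
— p. 617: *"The fields A′_j … are independent Gaussian random variables with the covariances C^{(j),L^jε}"* (independence =
product measure, the form in which r14's `B1Eq333GaussianFields` states the sentence). [cite: Balaban1982Higgs1, (3.33) p.617] -/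
noncomputable def lawPi (n : ℕ) : Measure ((j : Fin n) → (T.κ ((j : ℕ) + 1) → ℝ)) :=
  Measure.pi fun j : Fin n => B2Eq228Conditioning.gaussProb (cinvW T W ((j : ℕ) + 1))

/-- The accumulated fluctuation background `Σ_{j=1}^{n} α_jG_jQ*_jA′_j` of (3.33) (p14's `B1Eq333FluctuationIntegrals.bg`).
[cite: Balaban1982Higgs1, (3.33) p.617] -/
noncomputable def bgSum (n : ℕ) (A' : (j : Fin n) → (T.κ ((j : ℕ) + 1) → ℝ)) : ι → ℝ :=
  ∑ j : Fin n, bg T ((j : ℕ) + 1) (A' j)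

/-- No fluctuation field, no background. [cite: Balaban1982Higgs1, (3.33) p.617] -/
theorem bgSum_zero (A' : (j : Fin 0) → (T.κ ((j : ℕ) + 1) → ℝ)) : bgSum T 0 A' = 0 := by
  simp only [bgSum, Finset.univ_eq_empty, Finset.sum_empty]

/-- One more field: `Σ_{j=1}^{n+1} α_jG_jQ*_jA′_j = Σ_{j=1}^{n} α_jG_jQ*_jA′_j + α_{n+1}G_{n+1}Q*_{n+1}A′_{n+1}`.
[cite: Balaban1982Higgs1, (3.33) p.617] -/
theorem bgSum_snoc (n : ℕ) (A' : (j : Fin n) → (T.κ ((j : ℕ) + 1) → ℝ)) (t : T.κ (n + 1) → ℝ) :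
    bgSum T (n + 1) (Fin.snoc A' t : (j : Fin (n + 1)) → (T.κ ((j : ℕ) + 1) → ℝ)) = bgSum T n A' + bg T (n + 1) t := by
  unfold bgSum
  rw [Fin.sum_univ_castSucc]
  simp only [Fin.snoc_castSucc, Fin.snoc_last, Fin.val_castSucc, Fin.val_last]

variable {T W}

/-- **p14's printed nest IS the integral against the product law** (the Fubini repackaging left open in the scope line of
`B1Eq335FluctuationMeasure`): `fluctMean Φ n v = ∫ Φ(v + Σ_{j=1}^{n} α_jG_jQ*_jA′_j) dΠ_{j=1}^{n}dμ_j(A′_j)` whenever the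
integrand is integrable against the product law and the laws `dμ_j`, `1 ≤ j`, are probability measures (p14's
`law_isProbabilityMeasure`: automatic from the tower's Euclidean structure). [cite: Balaban1982Higgs1, (3.35) p.618] -/
theorem fluctMean_eq_integral_lawPi
    (hlaw : ∀ j, 1 ≤ j → IsProbabilityMeasure (B2Eq228Conditioning.gaussProb (cinvW T W j))) :
    ∀ (n : ℕ) (Φ : (ι → ℝ) → ℝ) (v : ι → ℝ),
      Integrable (fun A' => Φ (v + bgSum T n A')) (lawPi T W n) →
      fluctMean T W Φ n v = ∫ A', Φ (v + bgSum T n A') ∂(lawPi T W n)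
  | 0, Φ, v, _ => by
      have h0 : lawPi T W 0 = Measure.dirac (fun j : Fin 0 => j.elim0) := by
        rw [lawPi, Measure.pi_of_empty (fun j : Fin 0 => B2Eq228Conditioning.gaussProb (cinvW T W ((j : ℕ) + 1)))
          (fun j => j.elim0)]
      rw [h0, integral_dirac, bgSum_zero, add_zero]
      rfl
  | n + 1, Φ, v, hΦ => by
      haveI : ∀ j : Fin (n + 1), SigmaFinite (B2Eq228Conditioning.gaussProb (cinvW T W ((j : ℕ) + 1))) := fun j => by
        haveI := hlaw ((j : ℕ) + 1) (Nat.succ_pos _)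
        infer_instance
      have hpeel := integral_pi_eq_integral_integral_snoc
        (fun j : Fin (n + 1) => B2Eq228Conditioning.gaussProb (cinvW T W ((j : ℕ) + 1))) _ hΦ
      have hsec := ae_integrable_snoc
        (fun j : Fin (n + 1) => B2Eq228Conditioning.gaussProb (cinvW T W ((j : ℕ) + 1))) _ hΦ
      show (∫ t, fluctMean T W Φ n (v + bg T (n + 1) t) ∂(B2Eq228Conditioning.gaussProb (cinvW T W (n + 1)))) = _
      rw [lawPi, hpeel]
      refine integral_congr_ae ?_
      filter_upwards [hsec] with t ht
      have ht' : Integrable (fun A' => Φ (v + bg T (n + 1) t + bgSum T n A')) (lawPi T W n) := by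
        refine ht.congr (Filter.Eventually.of_forall fun A' => ?_)
        show Φ (v + bgSum T (n + 1) (Fin.snoc A' t)) = Φ (v + bg T (n + 1) t + bgSum T n A')
        rw [bgSum_snoc, add_assoc, add_comm (bgSum T n A')]
      rw [fluctMean_eq_integral_lawPi hlaw n Φ (v + bg T (n + 1) t) ht', lawPi]
      refine integral_congr_ae (Filter.Eventually.of_forall fun A' => ?_)
      show Φ (v + bg T (n + 1) t + bgSum T n A') = Φ (v + bgSum T (n + 1) (Fin.snoc A' t))
      rw [bgSum_snoc, add_assoc, add_comm (bgSum T n A')]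

/-- **Unnormalised = masses × ONE integral against the product law**: p14's `fluctInt Φ n v` (the printed nest of (3.35) on
the tower, levels `1, …, n`) `= (Π_{j=1}^{n} Z_j)·∫ Φ(v + Σ_j α_jG_jQ*_jA′_j) dΠ_j dμ_j(A′_j)`, `Z_j = gaussNorm (W_j(C^{(j)})⁻¹) ≠ 0`
(p14's `fluctInt_eq_fluctMean` composed with `fluctMean_eq_integral_lawPi`). [cite: Balaban1982Higgs1, (3.35) p.618] -/
theorem fluctInt_eq_mul_integral_lawPi
    (hlaw : ∀ j, 1 ≤ j → IsProbabilityMeasure (B2Eq228Conditioning.gaussProb (cinvW T W j)))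
    (hZ : ∀ j, 1 ≤ j → B13GaugeDevices.gaussNorm (cinvW T W j) ≠ 0)
    (n : ℕ) (Φ : (ι → ℝ) → ℝ) (v : ι → ℝ) (hΦ : Integrable (fun A' => Φ (v + bgSum T n A')) (lawPi T W n)) :
    fluctInt T W Φ n v
      = (∏ j ∈ Finset.Icc 1 n, B13GaugeDevices.gaussNorm (cinvW T W j)) * ∫ A', Φ (v + bgSum T n A') ∂(lawPi T W n) := by
  rw [fluctInt_eq_fluctMean Φ n (fun j hj _ => hZ j hj) v, fluctMean_eq_integral_lawPi hlaw n Φ v hΦ]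

/-- The same with the hypotheses DISCHARGED from the tower's Euclidean structure (p14's `law_isProbabilityMeasure`:
`T.Consistent`, the scalar products (1.5) of every step, symmetric weights and `H`). [cite: Balaban1982Higgs1, (3.35) p.618] -/
theorem fluctInt_eq_mul_integral_lawPi' {WE : Matrix ι ι ℝ} (h : T.Consistent)
    (E : ∀ j, 1 ≤ j → (T.step j).ScalarProducts WE (W j) (W (j + 1)))
    (symE : ∀ φ ψ : ι → ℝ, φ ⬝ᵥ (WE *ᵥ ψ) = ψ ⬝ᵥ (WE *ᵥ φ))
    (symW : ∀ j, 1 ≤ j → ∀ u w : T.κ j → ℝ, u ⬝ᵥ (W j *ᵥ w) = w ⬝ᵥ (W j *ᵥ u))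
    (symH : ∀ φ ψ : ι → ℝ, φ ⬝ᵥ (WE *ᵥ (T.H *ᵥ ψ)) = ψ ⬝ᵥ (WE *ᵥ (T.H *ᵥ φ)))
    (n : ℕ) (Φ : (ι → ℝ) → ℝ) (v : ι → ℝ) (hΦ : Integrable (fun A' => Φ (v + bgSum T n A')) (lawPi T W n)) :
    fluctInt T W Φ n v
      = (∏ j ∈ Finset.Icc 1 n, B13GaugeDevices.gaussNorm (cinvW T W j)) * ∫ A', Φ (v + bgSum T n A') ∂(lawPi T W n) :=
  fluctInt_eq_mul_integral_lawPi (fun j hj => (law_isProbabilityMeasure h E symE symW symH j hj).1)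
    (fun j hj => (law_isProbabilityMeasure h E symE symW symH j hj).2.ne') n Φ v hΦ

end AbstractTower

/-! ## 6. Knitting r14's `B1Eq333GaussianFields` (independence = product law) to p14's nest on the tower -/

section Knit333

open Matrix
open Literature.MathematicalPhysics.QuantumFieldTheory.Balaban1983to89.B1Eq333FluctuationIntegrals
open Literature.MathematicalPhysics.QuantumFieldTheory.Balaban1983to89.B1Eq335FluctuationMeasure

variable {ι : Type} [Fintype ι] [DecidableEq ι] (T : B1RG242.Tower ℝ ι) (W : ∀ j, Matrix (T.κ j) (T.κ j) ℝ)

/-- For a consistent tower with the scalar products (1.5), symmetric weights and `H`, every `W_j(C^{(j)})⁻¹`, `j ≥ 1`, is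
positive definite (p14's `gaussNorm_cinv_pos`, first component). [cite: Balaban1982Higgs1, (2.31) p.611] -/
theorem cinvW_posDef {WE : Matrix ι ι ℝ} (h : T.Consistent)
    (E : ∀ j, 1 ≤ j → (T.step j).ScalarProducts WE (W j) (W (j + 1)))
    (symE : ∀ φ ψ : ι → ℝ, φ ⬝ᵥ (WE *ᵥ ψ) = ψ ⬝ᵥ (WE *ᵥ φ))
    (symW : ∀ j, 1 ≤ j → ∀ u w : T.κ j → ℝ, u ⬝ᵥ (W j *ᵥ w) = w ⬝ᵥ (W j *ᵥ u))
    (symH : ∀ φ ψ : ι → ℝ, φ ⬝ᵥ (WE *ᵥ (T.H *ᵥ ψ)) = ψ ⬝ᵥ (WE *ᵥ (T.H *ᵥ φ))) (j : ℕ) (hj : 1 ≤ j) :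
    (cinvW T W j).PosDef :=
  (gaussNorm_cinv_pos (T.step j) (E j hj) symE (symW j hj) (symW (j + 1) (Nat.succ_pos j)) symH
    (h.G_arg j hj) (h.C_arg j hj)).1

/-- **r14's data of the p. 617 sentence FOR THE TOWER**: `B1Eq333GaussianFields.FluctData` with the level-`j+1` fluctuation
field indexed by `T.κ (j+1)` and covariance `C^{(j+1)} = (W_{j+1}(C^{(j+1)})⁻¹)⁻¹` (for the plain dot product), positive definite;
levels `1, …, n` (the level-0 field is p14's innermost functional). [cite: Balaban1982Higgs1, (3.33) p.617] -/
noncomputable def fluctData333 (n : ℕ) (hpd : ∀ j, 1 ≤ j → (cinvW T W j).PosDef) :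
    B1Eq333GaussianFields.FluctData n where
  ι := fun j => T.κ ((j : ℕ) + 1)
  fintype := fun _ => inferInstance
  deceq := fun _ => inferInstance
  C := fun j => (cinvW T W ((j : ℕ) + 1))⁻¹
  posDef := fun j => (hpd ((j : ℕ) + 1) (Nat.succ_pos _)).inv

/-- Its laws are p14's laws `dμ_j = gaussProb (W_j(C^{(j)})⁻¹)`. [cite: Balaban1982Higgs1, (3.35) p.618] -/
theorem fluctData333_law (n : ℕ) (hpd : ∀ j, 1 ≤ j → (cinvW T W j).PosDef) (j : Fin n) :
    (fluctData333 T W n hpd).law j = B2Eq228Conditioning.gaussProb (cinvW T W ((j : ℕ) + 1)) := by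
  show B2Eq228Conditioning.gaussProb ((cinvW T W ((j : ℕ) + 1))⁻¹)⁻¹ = _
  rw [Matrix.nonsing_inv_nonsing_inv _
    (isUnit_iff_ne_zero.2 (hpd _ (Nat.succ_pos _)).det_pos.ne')]

/-- **Its joint law (r14's `fluctLaw`, the measure whose components r14 proves independent Gaussian with covariances `C^{(j)}`)
IS the product law `lawPi` of §5.** [cite: Balaban1982Higgs1, (3.33) p.617] -/
theorem fluctData333_fluctLaw (n : ℕ) (hpd : ∀ j, 1 ≤ j → (cinvW T W j).PosDef) :
    (fluctData333 T W n hpd).fluctLaw = lawPi T W n := by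
  show Measure.pi (fluctData333 T W n hpd).law = Measure.pi _
  congr 1
  funext j
  exact fluctData333_law T W n hpd j

variable {T W}

/-- **p14's nest = the expectation against r14's joint law**: `fluctMean Φ n v = ∫ Φ(v + Σ_j α_jG_jQ*_jA′_j) dfluctLaw` — the
iterated Gaussian integrals of (3.35) over the levels `1, …, n` ARE the integral against the law under which
`B1Eq333GaussianFields` proves the `A′_j` independent Gaussian with covariances `C^{(j)}` (for every integrable integrand).
[cite: Balaban1982Higgs1, (3.33) p.617] -/
theorem fluctMean_eq_integral_fluctLaw (hpd : ∀ j, 1 ≤ j → (cinvW T W j).PosDef) (n : ℕ) (Φ : (ι → ℝ) → ℝ)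
    (v : ι → ℝ) (hΦ : Integrable (fun A' => Φ (v + bgSum T n A')) (lawPi T W n)) :
    fluctMean T W Φ n v = ∫ A', Φ (v + bgSum T n A') ∂(fluctData333 T W n hpd).fluctLaw := by
  rw [fluctData333_fluctLaw]
  exact fluctMean_eq_integral_lawPi (fun j hj => B2Eq228Conditioning.isProbabilityMeasure_gaussProb (hpd j hj)) n Φ v hΦ

end Knit333

/-! ## 7. The p. 617 sentence closed up: the density after `n + 1` steps as ONE Gaussian expectation -/

section Density333

open Matrix
open Literature.MathematicalPhysics.QuantumFieldTheory.Balaban1983to89.B1Eq333FluctuationIntegrals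
open Literature.MathematicalPhysics.QuantumFieldTheory.Balaban1983to89.B1Eq335FluctuationMeasure

variable {ι : Type} [Fintype ι] [DecidableEq ι] {T : B1RG242.Tower ℝ ι} {WE : Matrix ι ι ℝ}
  {W : ∀ j, Matrix (T.κ j) (T.κ j) ℝ} (c : ℕ → ℝ)

/-- **(3.33)/(3.35) on a consistent RG tower as ONE expectation over INDEPENDENT Gaussian fields**: after `n + 1`
renormalization steps the vector-field density at `B` (p14's `B1Eq333FluctuationIntegrals.rtIter`, the `(n+1)`-fold transformation
(2.4)–(2.6)/(2.16) with Lebesgue `dA`) equals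
`(Π_{j≤n}c_j)·e^{−½⟨B,Δ^{(n+1)}B⟩_{n+1}}·Z₀·(Π_{j=1}^{n}Z_j)·∫ F(A′₀ + α_{n+1}G_{n+1}Q*_{n+1}B + Σ_{j=1}^{n}α_jG_jQ*_jA′_j) d(dμ₀ ⊗ Π_{j=1}^{n}dμ_j)(A′₀, (A′_j)_j)`
— the integrand of (3.33) (`A = A′^{(0)} + Σ_j A′^{(j)} + A^{(n+1)}`) integrated against the PRODUCT of the laws `dμ₀ = gaussProb
(W_E(C^{(0)})⁻¹)` (covariance `C^{(0)} = G₁`) and `dμ_j = gaussProb (W_j(C^{(j)})⁻¹)`: p. 617 *"The fields A′_j … are independent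
Gaussian random variables with the covariances C^{(j),L^jε}. Also they are independent of the field A on the L^kε-lattice"* —
p14's nested `rtIter_eq_mean'` with the nest repackaged by `fluctMean_eq_integral_lawPi` and Fubini for `dμ₀ ⊗ Π_j dμ_j`;
hypotheses: those of `rtIter_eq_mean'` + integrability of the integrand against the product law. [cite: Balaban1982Higgs1, (3.33) p.617] -/
theorem rtIter_eq_integral_prod (h : T.Consistent) (E : ∀ j, 1 ≤ j → (T.step j).ScalarProducts WE (W j) (W (j + 1)))
    (posE : ∀ u : ι → ℝ, u ≠ 0 → 0 < u ⬝ᵥ (WE *ᵥ u))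
    (symE : ∀ φ ψ : ι → ℝ, φ ⬝ᵥ (WE *ᵥ ψ) = ψ ⬝ᵥ (WE *ᵥ φ))
    (symW : ∀ j, 1 ≤ j → ∀ u w : T.κ j → ℝ, u ⬝ᵥ (W j *ᵥ w) = w ⬝ᵥ (W j *ᵥ u))
    (symH : ∀ φ ψ : ι → ℝ, φ ⬝ᵥ (WE *ᵥ (T.H *ᵥ ψ)) = ψ ⬝ᵥ (WE *ᵥ (T.H *ᵥ φ)))
    (F : (ι → ℝ) → ℝ) (n : ℕ) (B : T.κ (n + 1) → ℝ)
    (hF : Integrable (fun p : (ι → ℝ) × ((j : Fin n) → (T.κ ((j : ℕ) + 1) → ℝ)) =>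
        F (p.1 + (bg T (n + 1) B + bgSum T n p.2)))
      ((B2Eq228Conditioning.gaussProb (ginvW T WE)).prod (lawPi T W n))) :
    rtIter T WE W c F n B
      = (∏ j ∈ Finset.range (n + 1), c j)
        * (Real.exp (-(1 / 2 * (B ⬝ᵥ (W (n + 1) *ᵥ ((T.step (n + 1)).Δk *ᵥ B)))))
          * ((B13GaugeDevices.gaussNorm (ginvW T WE)
              * ∏ j ∈ Finset.Icc 1 n, B13GaugeDevices.gaussNorm (cinvW T W j))
            * ∫ p, F (p.1 + (bg T (n + 1) B + bgSum T n p.2))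
                ∂((B2Eq228Conditioning.gaussProb (ginvW T WE)).prod (lawPi T W n)))) := by
  have hlaw : ∀ j, 1 ≤ j → IsProbabilityMeasure (B2Eq228Conditioning.gaussProb (cinvW T W j)) :=
    fun j hj => (law_isProbabilityMeasure h E symE symW symH j hj).1
  haveI : IsProbabilityMeasure (B2Eq228Conditioning.gaussProb (ginvW T WE)) :=
    (law₀_isProbabilityMeasure h (E 1 le_rfl) posE (symW 1 le_rfl) symH).1
  haveI : ∀ j : Fin n, SigmaFinite (B2Eq228Conditioning.gaussProb (cinvW T W ((j : ℕ) + 1))) := fun j => by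
    haveI := hlaw ((j : ℕ) + 1) (Nat.succ_pos _)
    infer_instance
  haveI : SigmaFinite (lawPi T W n) := by
    unfold lawPi; infer_instance
  rw [rtIter_eq_mean' c h E posE symE symW symH F n B,
    fluctMean_eq_integral_lawPi hlaw n _ (bg T (n + 1) B) hF.integral_prod_right,
    integral_prod_symm _ hF]

end Density333

/-! ## 8. ALL `n + 1` fluctuation fields, level 0 included, under ONE product law (r14's `FluctData (n + 1)`) -/

/-! ### 8a. Splitting the FIRST factor off a finite dependent product of measures -/

section PiCons

variable {n : ℕ}

/-- `Fin.consEquiv` — `(x_0, (x_{i+1})_{i<n}) ↦ (x_0, …, x_n)` — as a MEASURABLE equivalence of the dependent products (the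
`Fin.cons` twin of `snocMEquiv`: FIRST factor split off). (folklore, Mathlib-level; the measure-theoretic content of reading the printed `∫dμ_{C^{(k)}}(A′_k)…∫dμ_{C^{(1)}}(A′_1)∫dμ_{C^{(0)}}(A′_0)` of I (3.33), level 0 innermost, as ONE product measure) [cite: Balaban1982Higgs1, (3.33) p.617] -/
def consMEquiv (α : Fin (n + 1) → Type*) [∀ i, MeasurableSpace (α i)] :
    (α 0 × ((i : Fin n) → α (Fin.succ i))) ≃ᵐ ((i : Fin (n + 1)) → α i) where
  toEquiv := Fin.consEquiv α
  measurable_toFun := by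
    refine measurable_pi_iff.2 fun i => ?_
    refine Fin.cases ?_ (fun j => ?_) i
    · simp only [Fin.consEquiv_apply, Fin.cons_zero]
      exact measurable_fst
    · simp only [Fin.consEquiv_apply, Fin.cons_succ]
      exact (measurable_pi_apply j).comp measurable_snd
  measurable_invFun := by
    show Measurable fun f : (i : Fin (n + 1)) → α i => (f 0, Fin.tail f)
    exact (measurable_pi_apply 0).prodMk (measurable_pi_iff.2 fun j => measurable_pi_apply (Fin.succ j))

variable {α : Fin (n + 1) → Type*} [∀ i, MeasurableSpace (α i)]

/-- `consMEquiv` acts as `Fin.cons`. (folklore, Mathlib-level; the measure-theoretic content of reading the printed `∫dμ_{C^{(k)}}(A′_k)…∫dμ_{C^{(1)}}(A′_1)∫dμ_{C^{(0)}}(A′_0)` of I (3.33), level 0 innermost, as ONE product measure) [cite: Balaban1982Higgs1, (3.33) p.617] -/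
@[simp] theorem consMEquiv_apply (p : α 0 × ((i : Fin n) → α (Fin.succ i))) :
    consMEquiv α p = Fin.cons p.1 p.2 := rfl

/-- The preimage of a box under `consMEquiv` is the product of the first side with the box of the other sides. (folklore, Mathlib-level; the measure-theoretic content of reading the printed `∫dμ_{C^{(k)}}(A′_k)…∫dμ_{C^{(1)}}(A′_1)∫dμ_{C^{(0)}}(A′_0)` of I (3.33), level 0 innermost, as ONE product measure) [cite: Balaban1982Higgs1, (3.33) p.617] -/
theorem consMEquiv_preimage_pi (s : (i : Fin (n + 1)) → Set (α i)) :
    consMEquiv α ⁻¹' Set.univ.pi s = s 0 ×ˢ Set.univ.pi fun i : Fin n => s (Fin.succ i) := by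
  ext p
  simp only [Set.mem_preimage, Set.mem_univ_pi, Set.mem_prod, consMEquiv_apply]
  rw [Fin.forall_fin_succ]
  simp only [Fin.cons_zero, Fin.cons_succ]

/-- **`consMEquiv` carries `μ_0 ⊗ Π_{i<n} μ_{i+1}` to `Π_{i≤n} μ_i`** (σ-finite factors; the two measures agree on boxes). (folklore, Mathlib-level; the measure-theoretic content of reading the printed `∫dμ_{C^{(k)}}(A′_k)…∫dμ_{C^{(1)}}(A′_1)∫dμ_{C^{(0)}}(A′_0)` of I (3.33), level 0 innermost, as ONE product measure) [cite: Balaban1982Higgs1, (3.33) p.617] -/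
theorem measurePreserving_consMEquiv (μ : (i : Fin (n + 1)) → Measure (α i)) [∀ i, SigmaFinite (μ i)] :
    MeasurePreserving (consMEquiv α)
      ((μ 0).prod (Measure.pi fun i : Fin n => μ (Fin.succ i))) (Measure.pi μ) := by
  refine ⟨(consMEquiv α).measurable, (Measure.pi_eq fun s _ => ?_).symm⟩
  rw [MeasurableEquiv.map_apply, consMEquiv_preimage_pi, Measure.prod_prod, Measure.pi_pi,
    Fin.prod_univ_succ (fun i => μ i (s i))]

variable {E : Type*} [NormedAddCommGroup E]

/-- Integrability transported along `consMEquiv`. (folklore, Mathlib-level; the measure-theoretic content of reading the printed `∫dμ_{C^{(k)}}(A′_k)…∫dμ_{C^{(1)}}(A′_1)∫dμ_{C^{(0)}}(A′_0)` of I (3.33), level 0 innermost, as ONE product measure) [cite: Balaban1982Higgs1, (3.33) p.617] -/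
theorem integrable_comp_consMEquiv_iff (μ : (i : Fin (n + 1)) → Measure (α i)) [∀ i, SigmaFinite (μ i)]
    (f : ((i : Fin (n + 1)) → α i) → E) :
    Integrable (fun p : α 0 × ((i : Fin n) → α (Fin.succ i)) => f (consMEquiv α p))
        ((μ 0).prod (Measure.pi fun i : Fin n => μ (Fin.succ i)))
      ↔ Integrable f (Measure.pi μ) :=
  (measurePreserving_consMEquiv μ).integrable_comp_emb (consMEquiv α).measurableEmbedding

variable [NormedSpace ℝ E]

/-- **Fubini, first factor innermost**: `∫ f dΠ_{i≤n}μ_i = ∫dΠ_{i<n}μ_{i+1}(y) ∫ f(x, y_1, …, y_n) dμ_0(x)` for every integrable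
`f`. (folklore, Mathlib-level; the measure-theoretic content of reading the printed `∫dμ_{C^{(k)}}(A′_k)…∫dμ_{C^{(1)}}(A′_1)∫dμ_{C^{(0)}}(A′_0)` of I (3.33), level 0 innermost, as ONE product measure) [cite: Balaban1982Higgs1, (3.33) p.617] -/
theorem integral_pi_eq_integral_integral_cons (μ : (i : Fin (n + 1)) → Measure (α i)) [∀ i, SigmaFinite (μ i)]
    (f : ((i : Fin (n + 1)) → α i) → E) (hf : Integrable f (Measure.pi μ)) :
    ∫ x, f x ∂Measure.pi μ
      = ∫ y, ∫ x, f (Fin.cons x y) ∂(μ 0) ∂(Measure.pi fun i : Fin n => μ (Fin.succ i)) := by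
  rw [← (measurePreserving_consMEquiv μ).integral_comp',
    integral_prod_symm (fun p => f (consMEquiv α p)) ((integrable_comp_consMEquiv_iff μ f).2 hf)]
  rfl

end PiCons

/-! ### 8b. The full law and the p. 617 sentence as one expectation against it -/

section FullLaw

open Matrix
open Literature.MathematicalPhysics.QuantumFieldTheory.Balaban1983to89.B1Eq333FluctuationIntegrals
open Literature.MathematicalPhysics.QuantumFieldTheory.Balaban1983to89.B1Eq335FluctuationMeasure

variable {ι : Type} [Fintype ι] [DecidableEq ι] (T : B1RG242.Tower ℝ ι) (WE : Matrix ι ι ℝ)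
  (W : ∀ j, Matrix (T.κ j) (T.κ j) ℝ)

/-- The index family of ALL the fluctuation fields of the tower after `n + 1` steps: `A′₀` lives on the sites `ι` of the
initial lattice, `A′_{j+1}` on `T.κ (j+1)` (`j < n`). [cite: Balaban1982Higgs1, (3.33) p.617] -/
def Idx (n : ℕ) : Fin (n + 1) → Type := Fin.cases ι (fun j : Fin n => T.κ ((j : ℕ) + 1))

/-- all the index types are finite (plumbing instance). [cite: Balaban1982Higgs1, (3.33) p.617] -/
instance instFintypeIdx (n : ℕ) : ∀ j, Fintype (Idx T n j) :=
  Fin.cases (show Fintype ι from inferInstance) (fun j => show Fintype (T.κ ((j : ℕ) + 1)) from inferInstance)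

/-- all the index types have decidable equality (plumbing instance). [cite: Balaban1982Higgs1, (3.33) p.617] -/
instance instDecEqIdx (n : ℕ) : ∀ j, DecidableEq (Idx T n j) :=
  Fin.cases (show DecidableEq ι from inferInstance) (fun j => show DecidableEq (T.κ ((j : ℕ) + 1)) from inferInstance)

/-- The covariances of ALL the fluctuation fields: `C^{(0)} = (W_E(C^{(0)})⁻¹)⁻¹ = (ginvW)⁻¹` at level 0 and
`C^{(j+1)} = (W_{j+1}(C^{(j+1)})⁻¹)⁻¹` at level `j + 1` (for the plain dot product; p14's `ginvW` ∕ `cinvW`).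
[cite: Balaban1982Higgs1, (3.33) p.617] -/
noncomputable def covFull (n : ℕ) : ∀ j : Fin (n + 1), Matrix (Idx T n j) (Idx T n j) ℝ :=
  Fin.cases (show Matrix ι ι ℝ from (ginvW T WE)⁻¹)
    (fun j => show Matrix (T.κ ((j : ℕ) + 1)) (T.κ ((j : ℕ) + 1)) ℝ from (cinvW T W ((j : ℕ) + 1))⁻¹)

/-- level 0 of `covFull`. [cite: Balaban1982Higgs1, (3.33) p.617] -/
theorem covFull_zero (n : ℕ) : covFull T WE W n 0 = (show Matrix ι ι ℝ from (ginvW T WE)⁻¹) := rfl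
/-- level `j + 1` of `covFull`. [cite: Balaban1982Higgs1, (3.33) p.617] -/
theorem covFull_succ (n : ℕ) (j : Fin n) :
    covFull T WE W n j.succ
      = (show Matrix (T.κ ((j : ℕ) + 1)) (T.κ ((j : ℕ) + 1)) ℝ from (cinvW T W ((j : ℕ) + 1))⁻¹) := rfl

/-- The level-0 component `A′₀` of a full family `(A′₀, A′_1, …, A′_n)` (stated through this accessor so that the
elaborator sees the type `ι → ℝ` of `Idx T n 0 → ℝ`). [cite: Balaban1982Higgs1, (3.33) p.617] -/
def split0 (n : ℕ) (ω : (j : Fin (n + 1)) → (Idx T n j → ℝ)) : ι → ℝ := ω 0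

/-- The components `A′_1, …, A′_n` of a full family (same remark). [cite: Balaban1982Higgs1, (3.33) p.617] -/
def splitS (n : ℕ) (ω : (j : Fin (n + 1)) → (Idx T n j → ℝ)) : (j : Fin n) → (T.κ ((j : ℕ) + 1) → ℝ) :=
  fun j => ω j.succ

omit [Fintype ι] [DecidableEq ι] in
/-- `split0` of `Fin.cons x y` is `x`. [cite: Balaban1982Higgs1, (3.33) p.617] -/
theorem split0_cons (n : ℕ) (x : ι → ℝ) (y : (j : Fin n) → (T.κ ((j : ℕ) + 1) → ℝ)) :
    split0 T n (Fin.cons (α := fun j => Idx T n j → ℝ) x y) = x := rfl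

omit [Fintype ι] [DecidableEq ι] in
/-- `splitS` of `Fin.cons x y` is `y`. [cite: Balaban1982Higgs1, (3.33) p.617] -/
theorem splitS_cons (n : ℕ) (x : ι → ℝ) (y : (j : Fin n) → (T.κ ((j : ℕ) + 1) → ℝ)) :
    splitS T n (Fin.cons (α := fun j => Idx T n j → ℝ) x y) = y := rfl

/-- **r14's data of the p. 617 sentence for ALL `n + 1` fluctuation fields of the tower, level 0 INCLUDED**:
`B1Eq333GaussianFields.FluctData (n + 1)` with index family `Idx` and covariances `covFull`, all positive definite (given the
positive definiteness of `ginvW` and of the `cinvW j`, `j ≥ 1` — automatic on a consistent tower: `ginvW_posDef`, `cinvW_posDef`).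
[cite: Balaban1982Higgs1, (3.33) p.617] -/
noncomputable def fluctData333Full (n : ℕ) (hpd₀ : (ginvW T WE).PosDef)
    (hpd : ∀ j, 1 ≤ j → (cinvW T W j).PosDef) : B1Eq333GaussianFields.FluctData (n + 1) where
  ι := Idx T n
  fintype := instFintypeIdx T n
  deceq := instDecEqIdx T n
  C := covFull T WE W n
  posDef := fun j => by
    refine Fin.cases ?_ (fun i => ?_) j
    · exact hpd₀.inv
    · exact (hpd ((i : ℕ) + 1) (Nat.succ_pos _)).inv

/-- Its level-0 law is p14's `dμ₀ = gaussProb (W_E(C^{(0)})⁻¹)`. [cite: Balaban1982Higgs1, (3.35) p.618] -/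
theorem fluctData333Full_law_zero (n : ℕ) (hpd₀ : (ginvW T WE).PosDef) (hpd : ∀ j, 1 ≤ j → (cinvW T W j).PosDef) :
    (fluctData333Full T WE W n hpd₀ hpd).law 0 = B2Eq228Conditioning.gaussProb (ginvW T WE) := by
  show B2Eq228Conditioning.gaussProb ((ginvW T WE)⁻¹)⁻¹ = _
  rw [Matrix.nonsing_inv_nonsing_inv _ (isUnit_iff_ne_zero.2 hpd₀.det_pos.ne')]

/-- Its level-`j+1` law is p14's `dμ_{j+1} = gaussProb (W_{j+1}(C^{(j+1)})⁻¹)`. [cite: Balaban1982Higgs1, (3.35) p.618] -/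
theorem fluctData333Full_law_succ (n : ℕ) (hpd₀ : (ginvW T WE).PosDef) (hpd : ∀ j, 1 ≤ j → (cinvW T W j).PosDef)
    (j : Fin n) :
    (fluctData333Full T WE W n hpd₀ hpd).law j.succ = B2Eq228Conditioning.gaussProb (cinvW T W ((j : ℕ) + 1)) := by
  show B2Eq228Conditioning.gaussProb ((cinvW T W ((j : ℕ) + 1))⁻¹)⁻¹ = _
  rw [Matrix.nonsing_inv_nonsing_inv _ (isUnit_iff_ne_zero.2 (hpd _ (Nat.succ_pos _)).det_pos.ne')]

variable {WE} in
/-- On a consistent tower with the scalar products (1.5), `⟨·,·⟩_E` positive, `W₁` and `H` symmetric, `W_E(C^{(0)})⁻¹ = W_E G₁⁻¹`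
is positive definite (p14's `gaussNorm_ginv_pos`, first component). [cite: Balaban1982Higgs1, (2.31) p.611] -/
theorem ginvW_posDef (h : T.Consistent) (E1 : (T.step 1).ScalarProducts WE (W 1) (W (1 + 1)))
    (posE : ∀ u : ι → ℝ, u ≠ 0 → 0 < u ⬝ᵥ (WE *ᵥ u))
    (symW1 : ∀ u v : T.κ 1 → ℝ, u ⬝ᵥ (W 1 *ᵥ v) = v ⬝ᵥ (W 1 *ᵥ u))
    (symH : ∀ φ ψ : ι → ℝ, φ ⬝ᵥ (WE *ᵥ (T.H *ᵥ ψ)) = ψ ⬝ᵥ (WE *ᵥ (T.H *ᵥ φ))) : (ginvW T WE).PosDef :=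
  (gaussNorm_ginv_pos (T.step 1) E1 posE symW1 symH (h.G_arg 1 le_rfl)).1

variable {T WE W} (c : ℕ → ℝ)

/-- **(3.33)/(3.35) on the tower as ONE expectation against r14's `fluctLaw` OF ALL `n + 1` LEVELS**: the density after
`n + 1` steps (p14's `rtIter`, the `(n+1)`-fold transformation with Lebesgue `dA`)
`= (Π_{j≤n}c_j)·e^{−½⟨B,Δ^{(n+1)}B⟩}·Z₀(Π_{j=1}^{n}Z_j)·∫ F(A′₀ + α_{n+1}G_{n+1}Q*_{n+1}B + Σ_{j=1}^{n}α_jG_jQ*_jA′_j) dμ(A′₀, A′_1, …, A′_n)`,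
`dμ = (fluctData333Full …).fluctLaw = Π_{j=0}^{n} dμ_{C^{(j)}}` — the measure under which r14's `B1Eq333GaussianFields` PROVES
the `n + 1` fields independent Gaussian with means zero and covariances `C^{(j)}` (`iIndepFun_fluct`, `covariance_fluct`), i.e.
the p. 617 sentence *"A′₀, A′_1, …, A′_k are independent Gaussian random fields"* and the formula (3.33) as ONE statement
(`rtIter_eq_integral_prod` + Fubini for `dμ₀ ⊗ Π_{j≥1}dμ_j ≅ Π_{j≥0}dμ_j` along `consMEquiv`; hypotheses of p14's
`rtIter_eq_mean'`, integrability of the integrand against `dμ₀ ⊗ Π_j dμ_j`, and the positive definiteness feeding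
`fluctData333Full` — discharged in the primed form below). [cite: Balaban1982Higgs1, (3.33) p.617] -/
theorem rtIter_eq_integral_fluctLawFull (h : T.Consistent)
    (E : ∀ j, 1 ≤ j → (T.step j).ScalarProducts WE (W j) (W (j + 1)))
    (posE : ∀ u : ι → ℝ, u ≠ 0 → 0 < u ⬝ᵥ (WE *ᵥ u))
    (symE : ∀ φ ψ : ι → ℝ, φ ⬝ᵥ (WE *ᵥ ψ) = ψ ⬝ᵥ (WE *ᵥ φ))
    (symW : ∀ j, 1 ≤ j → ∀ u w : T.κ j → ℝ, u ⬝ᵥ (W j *ᵥ w) = w ⬝ᵥ (W j *ᵥ u))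
    (symH : ∀ φ ψ : ι → ℝ, φ ⬝ᵥ (WE *ᵥ (T.H *ᵥ ψ)) = ψ ⬝ᵥ (WE *ᵥ (T.H *ᵥ φ)))
    (F : (ι → ℝ) → ℝ) (n : ℕ) (B : T.κ (n + 1) → ℝ)
    (hF : Integrable (fun p : (ι → ℝ) × ((j : Fin n) → (T.κ ((j : ℕ) + 1) → ℝ)) =>
        F (p.1 + (bg T (n + 1) B + bgSum T n p.2)))
      ((B2Eq228Conditioning.gaussProb (ginvW T WE)).prod (lawPi T W n)))
    (hpd₀ : (ginvW T WE).PosDef) (hpd : ∀ j, 1 ≤ j → (cinvW T W j).PosDef) :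
    rtIter T WE W c F n B
      = (∏ j ∈ Finset.range (n + 1), c j)
        * (Real.exp (-(1 / 2 * (B ⬝ᵥ (W (n + 1) *ᵥ ((T.step (n + 1)).Δk *ᵥ B)))))
          * ((B13GaugeDevices.gaussNorm (ginvW T WE)
              * ∏ j ∈ Finset.Icc 1 n, B13GaugeDevices.gaussNorm (cinvW T W j))
            * ∫ ω, F (split0 T n ω + (bg T (n + 1) B + bgSum T n (splitS T n ω)))
                ∂(fluctData333Full T WE W n hpd₀ hpd).fluctLaw)) := by
  have hlaws : (Measure.pi fun i : Fin n => (fluctData333Full T WE W n hpd₀ hpd).law i.succ) = lawPi T W n := by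
    unfold lawPi
    congr 1
    funext i
    exact fluctData333Full_law_succ T WE W n hpd₀ hpd i
  have hlaw0 := fluctData333Full_law_zero T WE W n hpd₀ hpd
  have hF' : Integrable (fun ω : (fluctData333Full T WE W n hpd₀ hpd).FluctSpace =>
      F (split0 T n ω + (bg T (n + 1) B + bgSum T n (splitS T n ω))))
      (fluctData333Full T WE W n hpd₀ hpd).fluctLaw := by
    refine (integrable_comp_consMEquiv_iff (fluctData333Full T WE W n hpd₀ hpd).law _).1 ?_
    rw [hlaw0, hlaws]
    refine hF.congr (Filter.Eventually.of_forall fun p => ?_)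
    show F (p.1 + (bg T (n + 1) B + bgSum T n p.2))
      = F (split0 T n (Fin.cons (α := fun j => Idx T n j → ℝ) p.1 p.2) + (bg T (n + 1) B + bgSum T n (splitS T n (Fin.cons (α := fun j => Idx T n j → ℝ) p.1 p.2))))
    rw [split0_cons, splitS_cons]
  haveI : IsProbabilityMeasure (B2Eq228Conditioning.gaussProb (ginvW T WE)) :=
    (law₀_isProbabilityMeasure h (E 1 le_rfl) posE (symW 1 le_rfl) symH).1
  haveI : ∀ j : Fin n, SigmaFinite (B2Eq228Conditioning.gaussProb (cinvW T W ((j : ℕ) + 1))) := fun j => by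
    haveI := (law_isProbabilityMeasure h E symE symW symH ((j : ℕ) + 1) (Nat.succ_pos _)).1
    infer_instance
  haveI : SigmaFinite (lawPi T W n) := by
    unfold lawPi; infer_instance
  rw [rtIter_eq_integral_prod c h E posE symE symW symH F n B hF]
  congr 3
  show _ = ∫ ω, _ ∂(Measure.pi (fluctData333Full T WE W n hpd₀ hpd).law)
  rw [integral_pi_eq_integral_integral_cons _ _ hF', hlaw0, hlaws, integral_prod_symm _ hF]
  refine integral_congr_ae (Filter.Eventually.of_forall fun y => integral_congr_ae (Filter.Eventually.of_forall fun x => ?_))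
  show F (x + (bg T (n + 1) B + bgSum T n y))
    = F (split0 T n (Fin.cons (α := fun j => Idx T n j → ℝ) x y) + (bg T (n + 1) B + bgSum T n (splitS T n (Fin.cons (α := fun j => Idx T n j → ℝ) x y))))
  rw [split0_cons, splitS_cons]

/-- The same with the positive definiteness DISCHARGED from the tower's Euclidean structure (`ginvW_posDef`, `cinvW_posDef`):
the only hypotheses are those of p14's `rtIter_eq_mean'` and the integrability of the integrand. [cite: Balaban1982Higgs1, (3.33) p.617] -/
theorem rtIter_eq_integral_fluctLawFull' (h : T.Consistent)
    (E : ∀ j, 1 ≤ j → (T.step j).ScalarProducts WE (W j) (W (j + 1)))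
    (posE : ∀ u : ι → ℝ, u ≠ 0 → 0 < u ⬝ᵥ (WE *ᵥ u))
    (symE : ∀ φ ψ : ι → ℝ, φ ⬝ᵥ (WE *ᵥ ψ) = ψ ⬝ᵥ (WE *ᵥ φ))
    (symW : ∀ j, 1 ≤ j → ∀ u w : T.κ j → ℝ, u ⬝ᵥ (W j *ᵥ w) = w ⬝ᵥ (W j *ᵥ u))
    (symH : ∀ φ ψ : ι → ℝ, φ ⬝ᵥ (WE *ᵥ (T.H *ᵥ ψ)) = ψ ⬝ᵥ (WE *ᵥ (T.H *ᵥ φ)))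
    (F : (ι → ℝ) → ℝ) (n : ℕ) (B : T.κ (n + 1) → ℝ)
    (hF : Integrable (fun p : (ι → ℝ) × ((j : Fin n) → (T.κ ((j : ℕ) + 1) → ℝ)) =>
        F (p.1 + (bg T (n + 1) B + bgSum T n p.2)))
      ((B2Eq228Conditioning.gaussProb (ginvW T WE)).prod (lawPi T W n))) :
    rtIter T WE W c F n B
      = (∏ j ∈ Finset.range (n + 1), c j)
        * (Real.exp (-(1 / 2 * (B ⬝ᵥ (W (n + 1) *ᵥ ((T.step (n + 1)).Δk *ᵥ B)))))
          * ((B13GaugeDevices.gaussNorm (ginvW T WE)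
              * ∏ j ∈ Finset.Icc 1 n, B13GaugeDevices.gaussNorm (cinvW T W j))
            * ∫ ω, F (split0 T n ω + (bg T (n + 1) B + bgSum T n (splitS T n ω)))
                ∂(fluctData333Full T WE W n (ginvW_posDef T W h (E 1 le_rfl) posE (symW 1 le_rfl) symH)
                    (cinvW_posDef T W h E symE symW symH)).fluctLaw)) :=
  rtIter_eq_integral_fluctLawFull c h E posE symE symW symH F n B hF _ _

end FullLaw

end Literature.MathematicalPhysics.QuantumFieldTheory.Balaban1983to89.HiggsFluctFamilyNest
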